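import Summits.SmoothPoincare4.SmoothPoincare4.Theorems.CylinderEntropyImmortalAreaToFloorGaussianShells
import Summits.SmoothPoincare4.SmoothPoincare4.Theorems.CylinderEntropyImmortalAreaToFloorCutPiecePointwise
import HarnessLib

/-!
# Route `CylinderEntropy`, item `ImmortalAreaToFloor` (stmt-SmoothPoincare4-17197):
# Gaussian-weighted mass and Willmore bounds at a good point (module Γ3' of `BLUEPRINT-17197-c2.md`)

For a closed immersed cross-section `f : M⁴ → ℝ⁶`, a centre `x₀ ∈ ℝ⁶` and the backward heat kernel
weight `G_s = exp(-‖f - x₀‖²/(4s))/(4πs)²`, BALL information at `x₀` is converted into GAUSSIAN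
bounds uniform in the scale `s > 0`:
* `integral_gaussian_mul_le_of_ballGrowth` — for a non-negative integrable density `φ` on `M` with
  `∫_{‖f-x₀‖ ≤ r} φ ≤ Λ r⁴` for `0 < r ≤ R₀`: `∫ G_s φ ≤ 2048 e^{1/16} Λ/π² + (4πs)⁻² e^{-R₀²/(4s)} ∫ φ`
  (the landed dyadic-shell bound `lintegral_gaussian_le_of_quartic_growth` for `φ dμ`);
* `gaussianScale_tail_le` — `(4πs)⁻² e^{-R₀²/(4s)} ≤ R₀⁻⁴` for all `s > 0`;
* `gaussianMass_le_of_ballGrowth` — `∫ G_s dμ ≤ 2048 e^{1/16} C_A/π² + μ(M)/R₀⁴` from the quartic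
  (Ahlfors) growth `μ(‖f-x₀‖ ≤ r) ≤ C_A r⁴`, `r ≤ R₀`;
* `gaussianWillmore_le_of_ballGoodness` — at a point which is GOOD for `H²`
  (`∫_{‖f-x₀‖≤r} H² ≤ θ μ(‖f-x₀‖ ≤ r)`, `r ≤ R₀`) with Ahlfors growth:
  `∫ G_s H² ≤ 2048 e^{1/16} θ C_A/π² + (∫ H²)/R₀⁴` for ALL `s > 0`.
These are the constants `C_G` and `K_H` of the stacking argument (Γ6).

References: W. K. Allard, Ann. of Math. 95 (1972) §6 (good points, monotonicity at good points);
L. Simon, *Lectures on GMT* (1983) §17.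
-/

-- the prescribed namespace `Summit.SmoothPoincare4.SmoothPoincare4.…` repeats `SmoothPoincare4`
set_option linter.dupNamespace false

noncomputable section

open Bundle Set Function Filter MeasureTheory Module
open scoped Manifold ContDiff Topology RealInnerProductSpace BigOperators ENNReal

namespace Summit.SmoothPoincare4.SmoothPoincare4.Cruxes.CylinderRungTwo.KillingFlux

open Literature.Geometry.Riemannian Literature.Geometry.Riemannian.EuclideanHypersurface
open Literature.Geometry.Lorentzian Literature.Geometry.Lorentzian.PseudoRiemannianMetric
open Summit.SmoothPoincare4.SmoothPoincare4.Theorems.GaussianBounds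

/-! ## A general weighted form of the shell bound -/

section General

variable {X : Type*} [MeasurableSpace X]

/-- **Gaussian-weighted integrals from ball growth, weighted form.**  For a finite measure `μ`, a
measurable `d : X → ℝ`, a measurable integrable `φ ≥ 0` with `∫_{d ≤ r} φ dμ ≤ Λ r⁴` for
`0 < r ≤ R₀` (`Λ ≥ 0`), and every `s > 0`:
`∫ (e^{-d²/(4s)}/(4πs)²) φ dμ ≤ 2048 e^{1/16} Λ/π² + (e^{-R₀²/(4s)}/(4πs)²) ∫ φ dμ`
(the landed `lintegral_gaussian_le_of_quartic_growth` applied to the measure `φ dμ`).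
[cite: Allard1972, §6] -/
theorem integral_gaussian_mul_le_of_ballGrowth (μ : Measure X) [IsFiniteMeasure μ] {d φ : X → ℝ}
    (hd : Measurable d) (hφm : Measurable φ) (hφ0 : ∀ a, 0 ≤ φ a) (hφi : Integrable φ μ)
    {s R₀ Λ : ℝ} (hs : 0 < s) (hR₀ : 0 < R₀) (hΛ : 0 ≤ Λ)
    (hgrowth : ∀ r, 0 < r → r ≤ R₀ → ∫ a in {a | d a ≤ r}, φ a ∂μ ≤ Λ * r ^ 4) :
    ∫ a, (Real.exp (-(d a) ^ 2 / (4 * s)) / (4 * Real.pi * s) ^ 2) * φ a ∂μ ≤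
      2048 * Real.exp (1 / 16) * Λ / Real.pi ^ 2 +
        (Real.exp (-R₀ ^ 2 / (4 * s)) / (4 * Real.pi * s) ^ 2) * ∫ a, φ a ∂μ := by
  have hπ := Real.pi_pos
  set G : X → ℝ := fun a => Real.exp (-(d a) ^ 2 / (4 * s)) / (4 * Real.pi * s) ^ 2 with hG
  have hG0 : ∀ a, 0 ≤ G a := fun a => by positivity
  have hGle : ∀ a, G a ≤ 1 / (4 * Real.pi * s) ^ 2 := fun a => by
    apply div_le_div_of_nonneg_right _ (by positivity)
    rw [Real.exp_le_one_iff (x := -(d a) ^ 2 / (4 * s))]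
    exact div_nonpos_of_nonpos_of_nonneg (neg_nonpos.2 (sq_nonneg _)) (by positivity)
  have hGm : Measurable G := by fun_prop
  -- the weighted measure
  set β : Measure X := μ.withDensity fun a => ENNReal.ofReal (φ a) with hβ
  have hβset : ∀ r, β {a | d a ≤ r} = ENNReal.ofReal (∫ a in {a | d a ≤ r}, φ a ∂μ) := by
    intro r
    have hm : MeasurableSet {a | d a ≤ r} := hd measurableSet_Iic
    rw [hβ, withDensity_apply _ hm, ofReal_integral_eq_lintegral_ofReal hφi.integrableOn
      (Eventually.of_forall fun a => hφ0 a)]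
  have hgrowth' : ∀ r, 0 < r → r ≤ R₀ → β {a | d a ≤ r} ≤ ENNReal.ofReal (Λ * r ^ 4) := by
    intro r hr hrR
    rw [hβset]
    exact ENNReal.ofReal_le_ofReal (hgrowth r hr hrR)
  have key := lintegral_gaussian_le_of_quartic_growth β hd hs hR₀ hΛ hgrowth'
  -- identify the two sides
  have hGφi : Integrable (fun a => G a * φ a) μ := by
    refine Integrable.bdd_mul (c := 1 / (4 * Real.pi * s) ^ 2) hφi hGm.aestronglyMeasurable ?_
    exact Eventually.of_forall fun a => by
      rw [Real.norm_eq_abs, abs_of_nonneg (hG0 a)]; exact hGle a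
  have hlhs : ∫⁻ a, ENNReal.ofReal (G a) ∂β = ENNReal.ofReal (∫ a, G a * φ a ∂μ) := by
    rw [hβ, lintegral_withDensity_eq_lintegral_mul _ (by fun_prop) (by fun_prop)]
    rw [ofReal_integral_eq_lintegral_ofReal hGφi (Eventually.of_forall fun a =>
      mul_nonneg (hG0 a) (hφ0 a))]
    refine lintegral_congr fun a => ?_
    simp only [Pi.mul_apply]
    rw [← ENNReal.ofReal_mul (hφ0 a), mul_comm]
  have huniv : β univ = ENNReal.ofReal (∫ a, φ a ∂μ) := by
    rw [hβ, withDensity_apply _ MeasurableSet.univ, Measure.restrict_univ,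
      ofReal_integral_eq_lintegral_ofReal hφi (Eventually.of_forall fun a => hφ0 a)]
  rw [hlhs, huniv] at key
  have hI0 : 0 ≤ ∫ a, φ a ∂μ := integral_nonneg hφ0
  have hR : 0 ≤ 2048 * Real.exp (1 / 16) * Λ / Real.pi ^ 2 +
      (Real.exp (-R₀ ^ 2 / (4 * s)) / (4 * Real.pi * s) ^ 2) * ∫ a, φ a ∂μ := by positivity
  rw [← ENNReal.ofReal_mul (by positivity), ← ENNReal.ofReal_add (by positivity) (by positivity)]
    at key
  exact (ENNReal.ofReal_le_ofReal_iff hR).1 key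

/-- **The Gaussian tail beyond the goodness radius is scale-free small**:
`e^{-R₀²/(4s)}/(4πs)² ≤ 1/R₀⁴` for all `s > 0` (`y² e^{-y} ≤ 2` at `y = R₀²/(4s)`, `π² ≥ 2`).
[folklore] -/
theorem gaussianScale_tail_le {s R₀ : ℝ} (hs : 0 < s) (hR₀ : 0 < R₀) :
    Real.exp (-R₀ ^ 2 / (4 * s)) / (4 * Real.pi * s) ^ 2 ≤ 1 / R₀ ^ 4 := by
  have hπ := Real.pi_pos
  have hπ3 : 3 < Real.pi := Real.pi_gt_three
  set y : ℝ := R₀ ^ 2 / (4 * s) with hy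
  have hy0 : 0 ≤ y := by positivity
  -- `y² ≤ 2 e^{y}`
  have hexp : y ^ 2 / 2 ≤ Real.exp y := by
    have h := Real.pow_div_factorial_le_exp y hy0 2
    have hfac : ((Nat.factorial 2 : ℕ) : ℝ) = 2 := by norm_num [Nat.factorial]
    rwa [hfac] at h
  have hs4 : 4 * s = R₀ ^ 2 / y := by
    rw [hy]; field_simp
  have hypos : 0 < y := by positivity
  -- rewrite the left-hand side in terms of `y`
  have hlhs : Real.exp (-R₀ ^ 2 / (4 * s)) / (4 * Real.pi * s) ^ 2 =
      (y ^ 2 * Real.exp (-y)) / (Real.pi ^ 2 * R₀ ^ 4) := by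
    have h1 : -R₀ ^ 2 / (4 * s) = -y := by rw [hy]; ring
    have h2 : (4 * Real.pi * s) ^ 2 = Real.pi ^ 2 * (4 * s) ^ 2 := by ring
    rw [h1, h2, hs4]
    field_simp
  rw [hlhs, div_le_div_iff₀ (by positivity) (by positivity), one_mul]
  have h3 : y ^ 2 * Real.exp (-y) ≤ 2 := by
    rw [Real.exp_neg]
    have he : 0 < Real.exp y := Real.exp_pos y
    rw [mul_inv_le_iff₀ he]
    linarith
  have h4 : (2 : ℝ) ≤ Real.pi ^ 2 := by nlinarith
  calc y ^ 2 * Real.exp (-y) * R₀ ^ 4 ≤ 2 * R₀ ^ 4 :=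
      mul_le_mul_of_nonneg_right h3 (by positivity)
    _ ≤ Real.pi ^ 2 * R₀ ^ 4 := mul_le_mul_of_nonneg_right h4 (by positivity)

end General

/-! ## The Gaussian mass and the Gaussian-weighted Willmore energy at a good point -/

section GoodPoint

variable {M : Type*} [TopologicalSpace M] [ChartedSpace (EuclideanSpace ℝ (Fin 4)) M]
  [IsManifold (𝓡 4) ∞ M] [CompactSpace M] [T2Space M] [MeasurableSpace M] [BorelSpace M]

/-- **Gaussian mass from Ahlfors growth.**  For a closed immersed `f : M⁴ → ℝ⁶`, a centre `x₀`
with `μ(‖f - x₀‖ ≤ r) ≤ C_A r⁴` for `0 < r ≤ R₀`, and every `s > 0`: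
`∫ G_s dμ ≤ 2048 e^{1/16} C_A/π² + μ(M)/R₀⁴`. [cite: Allard1972, §6] -/
theorem gaussianMass_le_of_ballGrowth {f : M → EuclideanSpace ℝ (Fin 6)}
    (hf : (euclideanMetric (EuclideanSpace ℝ (Fin 6))).IsSpacelikeImmersion (𝓡 4) f)
    (x₀ : EuclideanSpace ℝ (Fin 6)) {s R₀ CA : ℝ} (hs : 0 < s) (hR₀ : 0 < R₀) (hCA : 0 ≤ CA)
    (hgrowth : ∀ r, 0 < r → r ≤ R₀ →
      (riemannianMeasure ((euclideanMetric (EuclideanSpace ℝ (Fin 6))).inducedRiemannianMetric f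
        contMDiff_pullbackBilin_holds hf)).real (f ⁻¹' Metric.closedBall x₀ r) ≤ CA * r ^ 4) :
    ∫ w, Real.exp (-‖f w - x₀‖ ^ 2 / (4 * s)) / (4 * Real.pi * s) ^ 2
        ∂riemannianMeasure ((euclideanMetric (EuclideanSpace ℝ (Fin 6))).inducedRiemannianMetric f
          contMDiff_pullbackBilin_holds hf) ≤
      2048 * Real.exp (1 / 16) * CA / Real.pi ^ 2 +
        (riemannianMeasure ((euclideanMetric (EuclideanSpace ℝ (Fin 6))).inducedRiemannianMetric f
          contMDiff_pullbackBilin_holds hf)).real univ / R₀ ^ 4 := by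
  set g₁ := (euclideanMetric (EuclideanSpace ℝ (Fin 6))).inducedRiemannianMetric f
    contMDiff_pullbackBilin_holds hf with hg₁
  set μ := riemannianMeasure g₁ with hμ
  haveI : IsFiniteMeasure μ := isFiniteMeasure_riemannianMeasure g₁
  have hfc : Continuous f := hf.contMDiff_self.continuous
  have hdc : Continuous fun w => ‖f w - x₀‖ := (hfc.sub continuous_const).norm
  have hset : ∀ r, {a | ‖f a - x₀‖ ≤ r} = f ⁻¹' Metric.closedBall x₀ r := fun r => by
    ext a; simp [Metric.mem_closedBall, dist_eq_norm]
  have hgrowth' : ∀ r, 0 < r → r ≤ R₀ → ∫ a in {a | ‖f a - x₀‖ ≤ r}, (1 : ℝ) ∂μ ≤ CA * r ^ 4 := by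
    intro r hr hrR
    rw [setIntegral_const, smul_eq_mul, mul_one, hset]
    exact hgrowth r hr hrR
  have key := integral_gaussian_mul_le_of_ballGrowth μ hdc.measurable measurable_const
    (fun _ => zero_le_one) (integrable_const 1) hs hR₀ hCA hgrowth'
  simp only [mul_one, integral_const, smul_eq_mul] at key
  have htail := gaussianScale_tail_le hs hR₀
  have hm0 : 0 ≤ μ.real univ := measureReal_nonneg
  calc ∫ w, Real.exp (-‖f w - x₀‖ ^ 2 / (4 * s)) / (4 * Real.pi * s) ^ 2 ∂μ
      ≤ 2048 * Real.exp (1 / 16) * CA / Real.pi ^ 2 +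
          Real.exp (-R₀ ^ 2 / (4 * s)) / (4 * Real.pi * s) ^ 2 * μ.real univ := key
    _ ≤ 2048 * Real.exp (1 / 16) * CA / Real.pi ^ 2 + 1 / R₀ ^ 4 * μ.real univ := by
        gcongr
    _ = _ := by ring

/-- **Gaussian-weighted Willmore energy at a good point.**  For a closed immersed cross-section
`f : M⁴ → ℝ⁶` with smooth unit normal `ν` and mean curvature `H`, a centre `x₀` which is GOOD for
`H²` up to radius `R₀` (`∫_{‖f-x₀‖≤r} H² ≤ θ μ(‖f-x₀‖ ≤ r)` for `0 < r ≤ R₀`) with Ahlfors growth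
`μ(‖f-x₀‖ ≤ r) ≤ C_A r⁴` there, and every `s > 0`:
`∫ G_s H² dμ ≤ 2048 e^{1/16} θ C_A/π² + (∫ H² dμ)/R₀⁴`. [cite: Allard1972, §6] -/
theorem gaussianWillmore_le_of_ballGoodness {f νf : M → EuclideanSpace ℝ (Fin 6)}
    (hf : (euclideanMetric (EuclideanSpace ℝ (Fin 6))).IsSpacelikeImmersion (𝓡 4) f)
    (hν : ContMDiff (𝓡 4) 𝓘(ℝ, EuclideanSpace ℝ (Fin 6)) ∞ νf)
    (x₀ : EuclideanSpace ℝ (Fin 6)) {s R₀ CA θ : ℝ} (hs : 0 < s) (hR₀ : 0 < R₀) (hCA : 0 ≤ CA)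
    (hθ : 0 ≤ θ)
    (hgrowth : ∀ r, 0 < r → r ≤ R₀ →
      (riemannianMeasure ((euclideanMetric (EuclideanSpace ℝ (Fin 6))).inducedRiemannianMetric f
        contMDiff_pullbackBilin_holds hf)).real (f ⁻¹' Metric.closedBall x₀ r) ≤ CA * r ^ 4)
    (hgood : ∀ r, 0 < r → r ≤ R₀ →
      ∫ w in f ⁻¹' Metric.closedBall x₀ r,
          (euclideanMetric (EuclideanSpace ℝ (Fin 6))).meanCurvature f contMDiff_pullbackBilin_holds
            hf νf w ^ 2
        ∂riemannianMeasure ((euclideanMetric (EuclideanSpace ℝ (Fin 6))).inducedRiemannianMetric f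
          contMDiff_pullbackBilin_holds hf) ≤
      θ * (riemannianMeasure ((euclideanMetric (EuclideanSpace ℝ (Fin 6))).inducedRiemannianMetric f
        contMDiff_pullbackBilin_holds hf)).real (f ⁻¹' Metric.closedBall x₀ r)) :
    ∫ w, (Real.exp (-‖f w - x₀‖ ^ 2 / (4 * s)) / (4 * Real.pi * s) ^ 2) *
          (euclideanMetric (EuclideanSpace ℝ (Fin 6))).meanCurvature f contMDiff_pullbackBilin_holds
            hf νf w ^ 2
        ∂riemannianMeasure ((euclideanMetric (EuclideanSpace ℝ (Fin 6))).inducedRiemannianMetric f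
          contMDiff_pullbackBilin_holds hf) ≤
      2048 * Real.exp (1 / 16) * (θ * CA) / Real.pi ^ 2 +
        (∫ w, (euclideanMetric (EuclideanSpace ℝ (Fin 6))).meanCurvature f contMDiff_pullbackBilin_holds
            hf νf w ^ 2
          ∂riemannianMeasure ((euclideanMetric (EuclideanSpace ℝ (Fin 6))).inducedRiemannianMetric f
            contMDiff_pullbackBilin_holds hf)) / R₀ ^ 4 := by
  set g₁ := (euclideanMetric (EuclideanSpace ℝ (Fin 6))).inducedRiemannianMetric f
    contMDiff_pullbackBilin_holds hf with hg₁
  set μ := riemannianMeasure g₁ with hμ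
  set Hm : M → ℝ := fun w => (euclideanMetric (EuclideanSpace ℝ (Fin 6))).meanCurvature f
    contMDiff_pullbackBilin_holds hf νf w with hHm
  haveI : IsFiniteMeasure μ := isFiniteMeasure_riemannianMeasure g₁
  have hfc : Continuous f := hf.contMDiff_self.continuous
  have hdc : Continuous fun w => ‖f w - x₀‖ := (hfc.sub continuous_const).norm
  have hHc : Continuous Hm := continuous_meanCurvature_euclidean hf hν
  have hH2c : Continuous fun w => Hm w ^ 2 := hHc.pow 2
  have hH2i : Integrable (fun w => Hm w ^ 2) μ := integrable_of_continuous (h := g₁) hH2c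
  have hset : ∀ r, {a | ‖f a - x₀‖ ≤ r} = f ⁻¹' Metric.closedBall x₀ r := fun r => by
    ext a; simp [Metric.mem_closedBall, dist_eq_norm]
  have hgrowth' : ∀ r, 0 < r → r ≤ R₀ → ∫ a in {a | ‖f a - x₀‖ ≤ r}, Hm a ^ 2 ∂μ ≤ θ * CA * r ^ 4 := by
    intro r hr hrR
    rw [hset]
    calc ∫ a in f ⁻¹' Metric.closedBall x₀ r, Hm a ^ 2 ∂μ
        ≤ θ * μ.real (f ⁻¹' Metric.closedBall x₀ r) := hgood r hr hrR
      _ ≤ θ * (CA * r ^ 4) := mul_le_mul_of_nonneg_left (hgrowth r hr hrR) hθ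
      _ = θ * CA * r ^ 4 := by ring
  have key := integral_gaussian_mul_le_of_ballGrowth μ hdc.measurable hH2c.measurable
    (fun a => sq_nonneg _) hH2i hs hR₀ (mul_nonneg hθ hCA) hgrowth'
  have htail := gaussianScale_tail_le hs hR₀
  have hW0 : 0 ≤ ∫ a, Hm a ^ 2 ∂μ := integral_nonneg fun a => sq_nonneg _
  calc ∫ w, (Real.exp (-‖f w - x₀‖ ^ 2 / (4 * s)) / (4 * Real.pi * s) ^ 2) * Hm w ^ 2 ∂μ
      ≤ 2048 * Real.exp (1 / 16) * (θ * CA) / Real.pi ^ 2 +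
          Real.exp (-R₀ ^ 2 / (4 * s)) / (4 * Real.pi * s) ^ 2 * ∫ a, Hm a ^ 2 ∂μ := key
    _ ≤ 2048 * Real.exp (1 / 16) * (θ * CA) / Real.pi ^ 2 + 1 / R₀ ^ 4 * ∫ a, Hm a ^ 2 ∂μ := by
        gcongr
    _ = _ := by ring

end GoodPoint

end Summit.SmoothPoincare4.SmoothPoincare4.Cruxes.CylinderRungTwo.KillingFlux

end
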